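import Summits.QuantumFields.YangMills.Theorems.UnitScaleTiltProp7ProjectorPerturbation
import HarnessLib

/-!
# Route `UnitScaleTilt`, crux K1 «MinimiserStabilityRegPr» (stmt-QuantumFields-19200), EX row `hGF[Lift]` (curved member) — **LOD LINE, PEN (L5″) FILE 2n-door (ABSTRACT):
# THE (R-N) COORDINATE ROW FROM A LOCAL GRAM-DIFFERENCE ROW** — the second resolvent identity on a coarse vector,
# `M⁻¹b − M′⁻¹b = M⁻¹((M′ − M)(M′⁻¹b))`, so that the (R-N) hypothesis `h2` of ✓`Prop7ProjectorPerturbationGram.norm_inner_starProjection_sub_le`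
# (`√Σ‖((M⁻¹ − M′⁻¹)b)_y‖² ≤ δ₂‖f‖`) follows from the global `‖M⁻¹‖ ≤ ν` ((L4′) coercivity) and ONE local row on the vector `c := M′⁻¹b` (which is exponentially concentrated at the
# cube by routeR-w2's ✓`Prop7CoarseGramInverseDecay`∕`…TdistDecay`): `√Σ‖((M′ − M)c)_y‖² ≤ δ_M‖f‖` ⟹ `δ₂ = ν·δ_M`.

Cell `ym3-torus` (HUMAN RULING D-0037, YM ladder rung R3 — NOT d = 4, NOT infinite volume, NOT a mass gap, NOT Clay).  Width seat `ym-routeR-w3` gen 12; ★p1 g24 LOCATE-L6-ASSEMBLY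
§1 Step I.2 (L5″), road (α); this seat's LOCATE-L5pp-FILE2 (bce81fab) §1 (R-N).  THEOREMS ONLY (0 `def`, 0 `sorry`), Mathlib + ✓`Prop7ProjectorPerturbation` (`sqrt_normSq_mulVec_le`);
`--supports stmt-QuantumFields-19200 --as helper`, count-neutral.  HONEST LABEL (★★OWNER RULING №33 (6)): curved γ-row supplier line (LOD localisation), pen (L5″); matrix algebra —
nothing of (3.49), Thm 3.1∕3.3, `h349`, `hGF`, EX ∕ 19200 is proved here.

WHAT IS PROVED (ns `Summit.QuantumFields.YangMills.Theorems.Prop7GramInverseDifferenceRow`; `‖·‖` on matrices = Mathlib's `L²`-operator norm).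
* `inv_mulVec_sub_inv_mulVec_eq` (the resolvent identity on a vector), ★★ `sqrt_normSq_inv_sub_inv_mulVec_le` (`√Σ‖((M⁻¹ − M′⁻¹)b)_y‖² ≤ ‖M⁻¹‖·√Σ‖((M′ − M)(M′⁻¹b))_y‖²`),
  ★★★ `gramInv_difference_row` (`‖M⁻¹‖ ≤ ν`, `√Σ‖((M′ − M)(M′⁻¹b))_y‖² ≤ δ_M·‖f‖` ⟹ `√Σ‖((M⁻¹ − M′⁻¹)b)_y‖² ≤ (ν·δ_M)·‖f‖` — the `h2` of ✓p752962).

References: T. Bałaban, CMP **99** (1985) 389–434 [Balaban1985BackgroundPropagators] ((3.22)–(3.23) p.394, (3.105) p.414).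
-/

set_option autoImplicit false

noncomputable section

open scoped BigOperators Matrix Matrix.Norms.L2Operator

namespace Summit.QuantumFields.YangMills.Theorems.Prop7GramInverseDifferenceRow

open Summit.QuantumFields.YangMills.Theorems.Prop7ProjectorPerturbation (sqrt_normSq_mulVec_le)

variable {m : Type*} [Fintype m] [DecidableEq m]

/-- **THE SECOND RESOLVENT IDENTITY ON A VECTOR**: for invertible `M, M′`, `M⁻¹b − M′⁻¹b = M⁻¹((M′ − M)(M′⁻¹b))`. [cite: Balaban1985BackgroundPropagators, (3.105) p.414] -/
theorem inv_mulVec_sub_inv_mulVec_eq (M M' : Matrix m m ℂ) (hM : IsUnit M.det) (hM' : IsUnit M'.det) (b : m → ℂ) :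
    M⁻¹ *ᵥ b - M'⁻¹ *ᵥ b = M⁻¹ *ᵥ ((M' - M) *ᵥ (M'⁻¹ *ᵥ b)) := by
  rw [Matrix.sub_mulVec, Matrix.mulVec_mulVec, Matrix.mul_nonsing_inv M' hM', Matrix.one_mulVec, Matrix.mulVec_sub, Matrix.mulVec_mulVec,
    Matrix.mulVec_mulVec, Matrix.nonsing_inv_mul M hM, Matrix.one_mul]

/-- ★★ **THE (R-N) SUM AGAINST THE GRAM-DIFFERENCE VECTOR**: `√Σ‖((M⁻¹ − M′⁻¹)b)_y‖² ≤ ‖M⁻¹‖·√Σ‖((M′ − M)(M′⁻¹b))_y‖²`.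
[cite: Balaban1985BackgroundPropagators, (3.22)–(3.23) p.394, (3.105) p.414] -/
theorem sqrt_normSq_inv_sub_inv_mulVec_le (M M' : Matrix m m ℂ) (hM : IsUnit M.det) (hM' : IsUnit M'.det) (b : m → ℂ) :
    Real.sqrt (∑ y, ‖((M⁻¹ - M'⁻¹) *ᵥ b) y‖ ^ 2) ≤ ‖M⁻¹‖ * Real.sqrt (∑ y, ‖((M' - M) *ᵥ (M'⁻¹ *ᵥ b)) y‖ ^ 2) := by
  rw [Matrix.sub_mulVec, inv_mulVec_sub_inv_mulVec_eq M M' hM hM' b]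
  exact sqrt_normSq_mulVec_le _ _

/-- ★★★ **THE (R-N) ROW FROM ONE LOCAL GRAM-DIFFERENCE ROW**: `‖M⁻¹‖ ≤ ν` and `√Σ‖((M′ − M)(M′⁻¹b))_y‖² ≤ δ_M·N` (`N = ‖f‖` at the member, `b_y = ⟪v_y, f⟫`) ⟹
**`√Σ‖((M⁻¹ − M′⁻¹)b)_y‖² ≤ (ν·δ_M)·N`** — the hypothesis `h2` of ✓`Prop7ProjectorPerturbationGram.norm_inner_starProjection_sub_le` with `δ₂ := ν·δ_M`.
[cite: Balaban1985BackgroundPropagators, (3.22)–(3.23) p.394, (3.105) p.414] -/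
theorem gramInv_difference_row (M M' : Matrix m m ℂ) (hM : IsUnit M.det) (hM' : IsUnit M'.det) (b : m → ℂ) {ν δM N : ℝ}
    (hν : ‖M⁻¹‖ ≤ ν) (hrow : Real.sqrt (∑ y, ‖((M' - M) *ᵥ (M'⁻¹ *ᵥ b)) y‖ ^ 2) ≤ δM * N) :
    Real.sqrt (∑ y, ‖((M⁻¹ - M'⁻¹) *ᵥ b) y‖ ^ 2) ≤ (ν * δM) * N := by
  refine (sqrt_normSq_inv_sub_inv_mulVec_le M M' hM hM' b).trans ?_
  calc ‖M⁻¹‖ * Real.sqrt (∑ y, ‖((M' - M) *ᵥ (M'⁻¹ *ᵥ b)) y‖ ^ 2) ≤ ν * (δM * N) :=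
        mul_le_mul hν hrow (Real.sqrt_nonneg _) ((norm_nonneg _).trans hν)
    _ = (ν * δM) * N := by ring

end Summit.QuantumFields.YangMills.Theorems.Prop7GramInverseDifferenceRow

end
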